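import Summits.HodgeConjecture.HodgeConjecture.Theorems.P2StubU2OfLetters
import Summits.HodgeConjecture.HodgeConjecture.Theorems.H413ThetaPinBridgeOfMaster
import Literature.NumberTheory.Automorphic.UnitaryGroupCotangentSpectralProjectionConj
import HarnessLib

/-!
# Crux `H413` — U2′ `StubU2CohFormsSpectrumIsThetaAt` FROM THE TWO ENGINE LETTERS (C) AND (D) ONLY

HC_CM is proved only modulo the 7 printed citations until rung 0 closes.

F0P2-p02 (g0), 2026-08-30.  PROOF FILE (one theorem, no `def`, no `sorry`) for crux item `stmt-HodgeConjecture-24833`, stub U2′ of the line of record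
`Cruxes/H413/Lines/P2ThetaDictionaryExists.lean` (TYPE ★ `SpectrumInterfaces.StubU2CohFormsSpectrumIsThetaAt`).  The by-name fold ★ `P2StubU2OfLetters.stubU2_of_letters`
(F0P2-p03, p793253) took four inputs `(hD) (hD̄) (hB)` with `hB` = the theta pin bridge; ★ `P2StubU2OfLettersFinal` (p793962) fed it `hB := spectrumIsTheta_of_cohFinComponent hC hC′`
(sockets (C), (C′)).  Two of the four sockets have since been REMOVED by theorems:
* (D̄) ⇐ (D): ★ `CotangentForms.antiholCotFormSpectralProjection_of_hol` (F0P2-p01 (g2), `UnitaryGroupCotangentSpectralProjectionConj`, complex conjugation on `L²`);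
* (C′) at the pin ⇐ the ★ UNCONDITIONAL line-class transport master (F0P4-p06 (g0), `Def411WeilCarriersAtLineClassTransportPU`) through ★
  `ThetaPinBridge.spectrumIsTheta_of_cohFinComponent_of_master` (F0P2-p02, `H413ThetaPinBridgeOfMaster`).
Hence **`stub_U2_cohFormsSpectrumIsThetaAt_of_C_D (hC : Rogawski1990.cohFinComponent_isTheta) (hD : CotangentForms.holCotFormSpectralProjection) : StubU2CohFormsSpectrumIsThetaAt`**
— U2′ modulo the two class-U engine letters (C) [Rogawski1990, Thm. 13.3.6 (c), §15.3; GelbartRogawski1991, Lem. 5.1.2] and (D) [BorelJacquet1979, §4.6; BorelWallach2000, XIII 1.2]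
and nothing else.  Registrar: `stub_U2_cohFormsSpectrumIsThetaAt := P2StubU2OfLettersCD.stub_U2_cohFormsSpectrumIsThetaAt_of_C_D stub_C_cohFinComponentIsTheta stub_D_holCotFormSpectralProjection`
(parent edition v4c: sockets {C, D, U4}).
-/

set_option autoImplicit false

-- the mandated namespace has the single-problem summit's repeated segment (`HodgeConjecture.HodgeConjecture`), as in every `Cruxes/…` module of this sub-problem
set_option linter.dupNamespace false

noncomputable section

namespace Summit.HodgeConjecture.HodgeConjecture.Cruxes.H413.P2StubU2OfLettersCD

open Literature.NumberTheory.Automorphic.UnitaryGroup.CotangentForms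
open Summit.HodgeConjecture.HodgeConjecture.Cruxes.H413.SpectrumInterfaces

/-- **U2′ FROM (C) AND (D) ALONE — `StubU2CohFormsSpectrumIsThetaAt` BY NAME.**  At every face of the pin, every irreducible representation of `U(V)(𝔸_{F⁺,f})`
occurring in the `(1,0) ⊕ (0,1)` cotangent automorphic forms of the factor of record is Hecke-related, at some compact open level, to a genuine weight-one `ω_V(t)`
with `ε` global — from the engine letter (C) `cohFinComponent_isTheta` and the spectral-projection letter (D) `holCotFormSpectralProjection`, through ★
`P2StubU2OfLetters.stubU2_of_letters`, ★ `antiholCotFormSpectralProjection_of_hol` ((D̄) ⇐ (D)) and ★ `ThetaPinBridge.spectrumIsTheta_of_cohFinComponent_of_master`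
(the pin bridge with the line-class transport PROVED). [cite: Rogawski1990, Thm. 13.3.6 (c); §14.6; §15.3; §12.3 p. 174] [cite: GelbartRogawski1991, Thm 5.1.1 p. 465; Lemma 5.1.2 p. 466]
[cite: Liu2021, proof of Prop. 4.13 l. 2131–2146; Rem. 4.14; App. D §D.1 Step 1 footnote, Lem. D.1] [cite: BorelJacquet1979, §4.6] -/
theorem stub_U2_cohFormsSpectrumIsThetaAt_of_C_D (hC : Literature.NumberTheory.Rogawski1990.cohFinComponent_isTheta)
    (hD : holCotFormSpectralProjection) : StubU2CohFormsSpectrumIsThetaAt :=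
  P2StubU2OfLetters.stubU2_of_letters hD (antiholCotFormSpectralProjection_of_hol hD)
    (ThetaPinBridge.spectrumIsTheta_of_cohFinComponent_of_master hC)

end Summit.HodgeConjecture.HodgeConjecture.Cruxes.H413.P2StubU2OfLettersCD

end
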